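import Summits.QuantumFields.YangMills.Theses.OneCertifiedCube
import Summits.QuantumFields.YangMills.Theorems.OneCertifiedCubeFiniteSizeCriterionRecursion
import Summits.QuantumFields.YangMills.Theorems.OneCertifiedCubeFiniteSizeCriterionTorus
import Summits.QuantumFields.YangMills.Theorems.OneCertifiedCubeFiniteSizeCriterionGrid
import HarnessLib

/-!
# `FiniteSizeCriterion` (item `stmt-QuantumFields-8895`, route `OneCertifiedCube`): proof

The total-variation finite-size criterion with universal threshold for lattice Yang–Mills theory:
if at cell size `b` the Wilson specification `ymSpecification ρ β` satisfies the finite-size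
condition at window `n` and threshold `ε` with `ε · M(n) < 1`, `M(n) = (4n+3)⁴ − (4n+1)⁴`, then
connected correlations of local gauge-invariant observables on the tori of side `2S+1` decay like
`C e^{−κ t/b}`, `κ = κ(n, ε)`.

Proof (Dobrushin–Shlosman 1985, §2; Martinelli 1999, §2.3; coupling-free form):
1. `box_influence_le` — on `ℤ⁴`, read the specification through the mesh-`b` grid cells
   (`OneCertifiedCubeFiniteSizeCriterionGrid`); the finite-size hypothesis becomes the grid finite-size
   condition (`gridFS_of_frameFS`), the block recursion (`recursion_decay`, file `…Recursion`) gives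
   single-cell boundary influence `≤ q^k`, `q = ε M(n)`, at agreement radius `k(2n+1)` cells, and
   the chain rule (`multiCell_influence_general_of_abs_le`, file `…ChainRule`) bounds the influence
   of ARBITRARY exterior data on an observable `A` supported in the cells of radius `R_A` by
   `2‖A‖ (2R_A+1)⁴ q^k`, for the kernel of the box of cells of radius `R_A + k(2n+1)`.
2. On the torus of side `2S+1 > 2t`, that box (with `k = ⌊(t − R_B − b(R_A+1)) / (b(2n+1))⌋`)
   together with its collar injects into the torus and misses the time-`t` translate of `B`, so
   `abs_latticeConnectedCorr_le_of_influence` (file `…Torus`: far-factor DLR equation + translation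
   invariance) gives `|⟨A;τ_tB⟩| ≤ 2‖A‖‖B‖(2R_A+1)⁴ q^k ≤ C e^{−κt/b}` with
   `κ = −log(max(q, 1/2))/(2n+1)` and `C = 2‖A‖‖B‖(2R_A+1)⁴ e^{κ(R_A+R_B+2n+2)}`; for
   `t < b(R_A+R_B+2n+2)` the trivial bound `2‖A‖‖B‖` suffices.
The hypothesis `(8n+7) b ≤ 2S+1` of the item is not needed (only `t ≤ S` is).

## References

* R. L. Dobrushin, S. B. Shlosman, *Constructive criterion for the uniqueness of Gibbs field*,
  in: Statistical Physics and Dynamical Systems (Birkhäuser 1985), §2.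
* F. Martinelli, *Lectures on Glauber dynamics for discrete spin models*, LNM 1717 (1999), §2.3.
* H.-O. Georgii, *Gibbs Measures and Phase Transitions*, 2nd ed. (de Gruyter 2011), §8.2.
-/

set_option autoImplicit false

noncomputable section

open MeasureTheory Filter
open Literature.Probability.LatticeModels
open Literature.MathematicalPhysics.QuantumLattice
open Literature.MathematicalPhysics.QuantumFieldTheory (wilsonMeasure isProbabilityMeasure_wilsonMeasure
  latticeConnectedCorr measurable_torusLift isSpecification_ymSpecification_of_t2Space)

namespace Summit.QuantumFields.YangMills.Theorems

namespace FiniteSizeCriterion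

/-! ## Geometry of the box of grid cells of radius `L` -/

/-- Membership in the box of grid cells of radius `L`: all cell coordinates in `[-L, L]`. -/
theorem mem_cellBox_iff {b : ℤ} (hb : 0 < b) (L : ℕ) (e : ZdEdge 4) :
    e ∈ (Fintype.piFinset fun _ : Fin 4 => Finset.Ico (-(b * L)) (b * (L + 1))) ×ˢ
        (Finset.univ : Finset (Fin 4)) ↔ ∀ i, -(L : ℤ) ≤ e.1 i / b ∧ e.1 i / b ≤ L := by
  simp only [Finset.mem_product, Finset.mem_univ, and_true, Fintype.mem_piFinset, Finset.mem_Ico]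
  refine forall_congr' fun i => ?_
  rw [Int.le_ediv_iff_mul_le hb, ← Int.lt_add_one_iff (a := e.1 i / b), Int.ediv_lt_iff_lt_mul hb]
  constructor <;> rintro ⟨h1, h2⟩ <;> constructor <;> linarith

/-- Reduction mod `M` is injective on a box of sites of width `< M`. -/
theorem injOn_torusProj_of_width {M : ℕ} {lo hi : ℤ} (hw : hi - lo < M) :
    Set.InjOn (Torus.proj M) {x : Site 4 | ∀ i, lo ≤ x i ∧ x i ≤ hi} := by
  intro x hx y hy hxy
  funext i
  have h1 : ((x i : ℤ) : ZMod M) = ((y i : ℤ) : ZMod M) := congr_fun hxy i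
  rw [ZMod.intCast_eq_intCast_iff_dvd_sub] at h1
  have h3 : |y i - x i| < (M : ℤ) := by
    rw [abs_lt]
    constructor <;> linarith [(hx i).1, (hx i).2, (hy i).1, (hy i).2]
  linarith [Int.eq_zero_of_abs_lt_dvd h1 h3]

/-! ## The influence of arbitrary exterior data on a box kernel -/

section Influence

variable {N : ℕ} {G : Type} [Group G] [TopologicalSpace G] [IsTopologicalGroup G]
  [CompactSpace G] [MeasurableSpace G] [BorelSpace G] [SecondCountableTopology G] [T2Space G]
  (ρ : G →* Matrix (Fin N) (Fin N) ℂ)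

/-- **Boundary influence of arbitrary exterior data on the box of cells of radius `R_A + k(2n+1)`,
for an observable of the cells of radius `R_A`**: at most `2‖A‖ (2R_A+1)⁴ (ε M(n))^k` under the
finite-size hypothesis of `FiniteSizeCriterion` at cell size `b` (grid finite-size condition,
block recursion `recursion_decay`, chain rule `multiCell_influence_general_of_abs_le`). -/
theorem box_influence_le (hρ : Continuous ρ) (β : ℝ) {b n : ℕ} (hb : 1 ≤ b) {ε : ℝ} (hε : 0 ≤ ε)
    (hFS : ∀ w : Fin 4 → ℤ → ℤ, (∀ i j, w i j + ((b : ℕ) : ℤ) ≤ w i (j + 1) ∧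
        w i (j + 1) ≤ w i j + 2 * ((b : ℕ) : ℤ)) →
      ∀ Y : Finset (Fin 4 → ℤ), Y ⊆ (Fintype.piFinset fun _ : Fin 4 =>
        Finset.Icc (-(2 * ((n : ℕ) : ℤ))) (2 * ((n : ℕ) : ℤ))) → (0 : Fin 4 → ℤ) ∈ Y →
      ∀ η η' : LGConfig 4 G, (∀ e ∈ (Fintype.piFinset fun _ : Fin 4 =>
        Finset.Icc (-(2 * ((n : ℕ) : ℤ))) (2 * ((n : ℕ) : ℤ))).biUnion (fun y : Fin 4 → ℤ =>
          (Fintype.piFinset fun i : Fin 4 => Finset.Ico (w i (y i)) (w i (y i + 1))) ×ˢ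
            (Finset.univ : Finset (Fin 4))), η e = η' e) →
      ∀ f : LGConfig 4 G → ℝ, IsCylinder f ((fun y : Fin 4 → ℤ =>
        (Fintype.piFinset fun i : Fin 4 => Finset.Ico (w i (y i)) (w i (y i + 1))) ×ˢ
          (Finset.univ : Finset (Fin 4))) 0) → Measurable f → (∀ U, 0 ≤ f U ∧ f U ≤ 1) →
      |(∫ U, f U ∂(ymSpecification ρ β (Y.biUnion (fun y : Fin 4 → ℤ =>
          (Fintype.piFinset fun i : Fin 4 => Finset.Ico (w i (y i)) (w i (y i + 1))) ×ˢ
            (Finset.univ : Finset (Fin 4)))) η)) -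
        ∫ U, f U ∂(ymSpecification ρ β (Y.biUnion (fun y : Fin 4 → ℤ =>
          (Fintype.piFinset fun i : Fin 4 => Finset.Ico (w i (y i)) (w i (y i + 1))) ×ˢ
            (Finset.univ : Finset (Fin 4)))) η')| ≤ ε)
    (k RA : ℕ) {A : LGConfig 4 G → ℝ} (hAm : Measurable A) {CA : ℝ} (hAb : ∀ U, |A U| ≤ CA)
    {SA : Finset (ZdEdge 4)} (hAS : IsCylinder A SA) (hRA : ∀ e ∈ SA, ∀ i, |e.1 i| ≤ RA)
    (η η' : LGConfig 4 G) :
    |(∫ U, A U ∂(ymSpecification ρ β ((Fintype.piFinset fun _ : Fin 4 =>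
        Finset.Ico (-((b : ℤ) * (RA + k * (2 * n + 1) : ℕ)))
          ((b : ℤ) * ((RA + k * (2 * n + 1) : ℕ) + 1))) ×ˢ (Finset.univ : Finset (Fin 4))) η)) -
      ∫ U, A U ∂(ymSpecification ρ β ((Fintype.piFinset fun _ : Fin 4 =>
        Finset.Ico (-((b : ℤ) * (RA + k * (2 * n + 1) : ℕ)))
          ((b : ℤ) * ((RA + k * (2 * n + 1) : ℕ) + 1))) ×ˢ (Finset.univ : Finset (Fin 4))) η')| ≤
      2 * CA * ((2 * RA + 1) ^ 4 *
        (ε * (((2 * (2 * n + 1) + 1) ^ 4 - (2 * (2 * n) + 1) ^ 4 : ℕ) : ℝ)) ^ k) := by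
  classical
  have hb0 : (0 : ℤ) < (b : ℤ) := by exact_mod_cast hb
  have hγ := isSpecification_ymSpecification_of_t2Space (d := 4) ρ hρ β
  set L : ℕ := RA + k * (2 * n + 1) with hL
  -- the single-cell influence bound from the block recursion
  have hR := recursion_decay (d := 4) hγ
    (fun Λ f T hf hT => dependsOn_integral_ymSpecification ρ hρ β Λ hf hT)
    (cell := fun (v : ZdEdge 4) (i : Fin 4) => v.1 i / (b : ℤ)) (grid_hC1 hb0) (finite_gridCell hb0)
    hε (gridFS_of_frameFS (ymSpecification ρ β) hb hFS) k
  -- the chain rule over the `(2 R_A + 1)⁴` cells of radius `R_A`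
  have hY : (Fintype.piFinset fun _ : Fin 4 => Finset.Icc (-(RA : ℤ)) RA).card = (2 * RA + 1) ^ 4 := by
    have h := card_piFinset_Icc (d := 4) (0 : Fin 4 → ℤ) RA
    simpa using h
  have key := multiCell_influence_general_of_abs_le
    (cell := fun (v : ZdEdge 4) (i : Fin 4) => v.1 i / (b : ℤ))
    (near := fun (y : Fin 4 → ℤ) (v : ZdEdge 4) => ∀ i, |v.1 i / (b : ℤ) - y i| ≤ k * (2 * n + 1))
    (fun v i => by simp only [sub_self, abs_zero]; positivity) hγ hR
    (Fintype.piFinset fun _ : Fin 4 => Finset.Icc (-(RA : ℤ)) RA)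
    ((Fintype.piFinset fun _ : Fin 4 => Finset.Ico (-((b : ℤ) * L)) ((b : ℤ) * (L + 1))) ×ˢ
      (Finset.univ : Finset (Fin 4)))
    (fun v w hvw hv => by
      rw [mem_cellBox_iff hb0] at hv ⊢
      intro i
      have h : v.1 i / (b : ℤ) = w.1 i / (b : ℤ) := congrFun hvw i
      rw [← h]
      exact hv i)
    A hAm hAb
    (fun σ σ' h => hAS fun e he => h e (by
      show (fun i => e.1 i / (b : ℤ)) ∈ Fintype.piFinset fun _ : Fin 4 => Finset.Icc (-(RA : ℤ)) RA
      rw [Fintype.mem_piFinset]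
      intro i
      have h1 := abs_le.1 (hRA e (Finset.mem_coe.1 he) i)
      have hlo : -(RA : ℤ) ≤ e.1 i / b :=
        (Int.le_ediv_iff_mul_le hb0).2 (by nlinarith [h1.1])
      have hhi : e.1 i / b ≤ RA := by
        have : e.1 i / (b : ℤ) < RA + 1 := (Int.ediv_lt_iff_lt_mul hb0).2 (by nlinarith [h1.2])
        omega
      exact Finset.mem_Icc.2 ⟨hlo, hhi⟩))
    η η'
    (fun y hy v hv hd => by
      exfalso
      rw [mem_cellBox_iff hb0] at hv
      refine hv fun i => ?_
      have hyi := Finset.mem_Icc.1 (Fintype.mem_piFinset.1 hy i)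
      have hdi := abs_le.1 (hd i)
      simp only [hL]
      push_cast
      constructor <;> linarith [hyi.1, hyi.2, hdi.1, hdi.2])
  rw [hY] at key
  simpa [hL] using key

end Influence

end FiniteSizeCriterion

/-! ## The theorem -/

open FiniteSizeCriterion in
/-- **`FiniteSizeCriterion` holds** (item `stmt-QuantumFields-8895` of route `OneCertifiedCube`):
the total-variation finite-size criterion with universal threshold `ε M(n) < 1` implies exponential
decay `C e^{−κ t / b}` of connected correlations of local gauge-invariant observables on all tori,
`κ = −log(max(ε M(n), 1/2))/(2n+1)` depending on `n, ε` only. See the module docstring for the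
proof (Dobrushin–Shlosman block recursion on mesh-`b` cells, chain rule, torus DLR transfer). -/
theorem FiniteSizeCriterion_proof :
    Summit.QuantumFields.YangMills.Theses.OneCertifiedCube.FiniteSizeCriterion := by
  unfold Summit.QuantumFields.YangMills.Theses.OneCertifiedCube.FiniteSizeCriterion
  intro n ε _hn hε hqlt
  -- the decay rate
  set q : ℝ := ε * ((((4 * n + 3) ^ 4 - (4 * n + 1) ^ 4 : ℕ)) : ℝ) with hq
  have hq0 : 0 ≤ q := by rw [hq]; positivity
  set r : ℝ := max q (1 / 2)
  have hr0 : 0 < r := lt_of_lt_of_le (by norm_num) (le_max_right _ _)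
  have hr1 : r < 1 := max_lt hqlt (by norm_num)
  have hqr0 : q ≤ r := le_max_left _ _
  have hlogr : Real.log r < 0 := Real.log_neg hr0 hr1
  set κ : ℝ := -Real.log r / (2 * n + 1) with hκ
  have hn1 : (0 : ℝ) < 2 * n + 1 := by positivity
  have hn1' : (2 * (n : ℝ) + 1) ≠ 0 := hn1.ne'
  have hκ0 : 0 < κ := by rw [hκ]; exact div_pos (by linarith) hn1
  have hlogr' : Real.log r = -(κ * (2 * n + 1)) := by rw [hκ]; field_simp
  refine ⟨κ, hκ0, ?_⟩
  intro G _ _ _ _ _ _ N ρ hρc hρi A B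
  haveI : T2Space G := (hρc.isClosedEmbedding hρi).isEmbedding.t2Space
  haveI : SecondCountableTopology G :=
    (hρc.isClosedEmbedding hρi).isEmbedding.secondCountableTopology
  obtain ⟨CA, hCA⟩ := A.bounded
  obtain ⟨CB, hCB⟩ := B.bounded
  have hCA0 : 0 ≤ CA := (abs_nonneg _).trans (hCA fun _ => 1)
  have hCB0 : 0 ≤ CB := (abs_nonneg _).trans (hCB fun _ => 1)
  -- the radii of the supports
  set RA : ℕ := A.supp.sup fun e => Finset.univ.sup fun i => (e.1 i).natAbs
  set RB : ℕ := B.supp.sup fun e => Finset.univ.sup fun i => (e.1 i).natAbs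
  have hRA : ∀ e ∈ A.supp, ∀ i, |e.1 i| ≤ RA := fun e he i => by
    rw [Int.abs_eq_natAbs, Int.ofNat_le]
    exact (Finset.le_sup (f := fun i => (e.1 i).natAbs) (Finset.mem_univ i)).trans
      (Finset.le_sup (f := fun e : ZdEdge 4 => Finset.univ.sup fun i => (e.1 i).natAbs) he)
  have hRB : ∀ e ∈ B.supp, ∀ i, |e.1 i| ≤ RB := fun e he i => by
    rw [Int.abs_eq_natAbs, Int.ofNat_le]
    exact (Finset.le_sup (f := fun i => (e.1 i).natAbs) (Finset.mem_univ i)).trans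
      (Finset.le_sup (f := fun e : ZdEdge 4 => Finset.univ.sup fun i => (e.1 i).natAbs) he)
  clear_value RA RB
  -- the constant
  set c0 : ℝ := RA + RB + 2 * n + 2 with hc0
  clear_value q r κ c0
  refine ⟨2 * CA * CB * (2 * RA + 1) ^ 4 * Real.exp (κ * c0), ?_⟩
  intro β b hb hFS S _hS t ht
  haveI := isProbabilityMeasure_wilsonMeasure (d := 4) (L := 2 * S + 1) ρ hρc β
  have hb0 : (0 : ℤ) < b := by exact_mod_cast hb
  have hbR : (1 : ℝ) ≤ b := by exact_mod_cast hb
  have hbR0 : (0 : ℝ) < b := by linarith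
  -- the trivial bound
  have htriv : |latticeConnectedCorr ρ β (2 * S + 1) A.F B.F t| ≤ 2 * CA * CB := by
    unfold Literature.MathematicalPhysics.QuantumFieldTheory.latticeConnectedCorr
    have h1 : |∫ U, A.F (torusLift (2 * S + 1) U) *
        B.F (Literature.MathematicalPhysics.QuantumLattice.configShift (-Pi.single 0 (t : ℤ))
          (torusLift (2 * S + 1) U)) ∂(wilsonMeasure (d := 4) (L := 2 * S + 1) ρ β)| ≤ CA * CB :=
      abs_integral_le_of_abs_le fun U => by
        rw [abs_mul]
        exact mul_le_mul (hCA _) (hCB _) (abs_nonneg _) hCA0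
    have h2 : |∫ U, A.F (torusLift (2 * S + 1) U) ∂(wilsonMeasure (d := 4) (L := 2 * S + 1) ρ β)| ≤
        CA := abs_integral_le_of_abs_le fun U => hCA _
    have h3 : |∫ U, B.F (torusLift (2 * S + 1) U) ∂(wilsonMeasure (d := 4) (L := 2 * S + 1) ρ β)| ≤
        CB := abs_integral_le_of_abs_le fun U => hCB _
    calc _ ≤ |∫ U, A.F (torusLift (2 * S + 1) U) *
          B.F (Literature.MathematicalPhysics.QuantumLattice.configShift (-Pi.single 0 (t : ℤ))
            (torusLift (2 * S + 1) U)) ∂(wilsonMeasure (d := 4) (L := 2 * S + 1) ρ β)| +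
          |(∫ U, A.F (torusLift (2 * S + 1) U) ∂(wilsonMeasure (d := 4) (L := 2 * S + 1) ρ β)) *
            ∫ U, B.F (torusLift (2 * S + 1) U) ∂(wilsonMeasure (d := 4) (L := 2 * S + 1) ρ β)| :=
          abs_sub _ _
      _ ≤ CA * CB + CA * CB := by
          rw [abs_mul]
          exact add_le_add h1 (mul_le_mul h2 h3 (abs_nonneg _) hCA0)
      _ = 2 * CA * CB := by ring
  -- the arithmetic of `k = ⌊(t − R_B − b(R_A+1)) / (b(2n+1))⌋`
  obtain ⟨Q, hQ⟩ : ∃ Q : ℕ, Q = b * (2 * n + 1) := ⟨_, rfl⟩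
  obtain ⟨P, hP⟩ : ∃ P : ℕ, P = b * (RA + 1) := ⟨_, rfl⟩
  have hQ1 : 1 ≤ Q := by rw [hQ]; nlinarith
  have hC0 : 0 ≤ 2 * CA * CB * (2 * RA + 1 : ℝ) ^ 4 := by positivity
  have hgoal : ∀ {x : ℝ}, x ≤ 2 * CA * CB * (2 * RA + 1) ^ 4 * Real.exp (κ * c0 - κ * t / b) →
      x ≤ 2 * CA * CB * (2 * RA + 1) ^ 4 * Real.exp (κ * c0) * Real.exp (-(κ * t / b)) := by
    intro x hx
    rwa [mul_assoc _ (Real.exp _), ← Real.exp_add, ← sub_eq_add_neg]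
  by_cases hcase : Q ≤ t - RB - P
  swap
  · -- few cells between the supports: the trivial bound suffices
    apply hgoal
    have htlt : t < Q + RB + P := by omega
    have htb : (t : ℝ) ≤ b * c0 := by
      have h1 : (t : ℝ) < Q + RB + P := by exact_mod_cast htlt
      have h2 : (Q : ℝ) = b * (2 * n + 1) := by rw [hQ]; push_cast; ring
      have h3 : (P : ℝ) = b * (RA + 1) := by rw [hP]; push_cast; ring
      have h4 : (RB : ℝ) ≤ b * RB := le_mul_of_one_le_left (by positivity) hbR
      rw [hc0]
      linarith only [h1, h2, h3, h4]
    have hexp : 1 ≤ Real.exp (κ * c0 - κ * t / b) := by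
      refine Real.one_le_exp ?_
      rw [sub_nonneg, mul_div_assoc]
      exact mul_le_mul_of_nonneg_left ((div_le_iff₀ hbR0).2 (by linarith only [htb])) hκ0.le
    have hRA1 : (1 : ℝ) ≤ (2 * RA + 1 : ℝ) ^ 4 :=
      one_le_pow₀ (by linarith only [(Nat.cast_nonneg RA : (0 : ℝ) ≤ RA)])
    calc |latticeConnectedCorr ρ β (2 * S + 1) A.F B.F t| ≤ 2 * CA * CB := htriv
      _ = 2 * CA * CB * 1 * 1 := by ring
      _ ≤ 2 * CA * CB * (2 * RA + 1) ^ 4 * Real.exp (κ * c0 - κ * t / b) := by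
          gcongr
  · -- the main case: `k ≥ 1` block-recursion steps fit between the supports
    apply hgoal
    obtain ⟨k, hk⟩ : ∃ k : ℕ, k = (t - RB - P) / Q := ⟨_, rfl⟩
    have hkQ : k * Q ≤ t - RB - P := by rw [hk]; exact Nat.div_mul_le_self _ _
    have hlt : t - RB - P < k * Q + Q := by rw [hk]; exact Nat.lt_div_mul_add (by omega)
    have ht_eq : t - RB - P + RB + P = t := by omega
    have hRBP : RB + P ≤ t := by
      have h1 : 0 < t - (RB + P) := by rw [← Nat.sub_sub]; omega
      exact (Nat.sub_pos_iff_lt.1 h1).le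
    have hsum : k * Q + RB + P ≤ t := by
      have h : k * Q + (RB + P) ≤ t :=
        (Nat.le_sub_iff_add_le hRBP).1 (by rw [Nat.sub_sub] at hkQ; exact hkQ)
      simpa only [Nat.add_assoc] using h
    obtain ⟨L, hL⟩ : ∃ L : ℕ, L = RA + k * (2 * n + 1) := ⟨_, rfl⟩
    -- integer forms of the two separation facts
    have hbL : (b : ℤ) * (L + 1) = P + k * Q := by rw [hL, hP, hQ]; push_cast; ring
    have hI1 : (b : ℤ) * L + b + RB ≤ t := by
      have h : ((k * Q : ℕ) : ℤ) + RB + P ≤ t := by exact_mod_cast hsum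
      push_cast at h
      linarith only [h, hbL]
    have hI2 : (t : ℤ) ≤ S := by exact_mod_cast ht
    have hb1 : (1 : ℤ) ≤ b := by exact_mod_cast hb
    have hRAL : (RA : ℤ) ≤ L := by
      have h0 : (0 : ℤ) ≤ k * (2 * n + 1) := by positivity
      rw [hL]; push_cast; linarith only [h0]
    have hLbL : (L : ℤ) ≤ b * L := le_mul_of_one_le_left (by positivity) hb1
    -- the box `Λ` of cells of radius `L`
    obtain ⟨Λ, hΛ⟩ : ∃ Λ : Finset (ZdEdge 4), Λ = (Fintype.piFinset fun _ : Fin 4 =>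
      Finset.Ico (-((b : ℤ) * L)) ((b : ℤ) * (L + 1))) ×ˢ (Finset.univ : Finset (Fin 4)) :=
      ⟨_, rfl⟩
    have hmemΛ : ∀ e ∈ Λ, ∀ i, -((b : ℤ) * L) ≤ e.1 i ∧ e.1 i ≤ b * L + b - 1 := by
      intro e he i
      rw [hΛ, Finset.mem_product, Fintype.mem_piFinset] at he
      have h := Finset.mem_Ico.1 (he.1 i)
      constructor <;> linarith only [h.1, h.2]
    -- (i) `Λ`, the support of `A` and the collar of `Λ` inject into the torus
    have hwide : ∀ e ∈ Λ ∪ A.supp ∪ (plaquettesTouching Λ).biUnion plaquetteEdges, ∀ i,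
        -((b : ℤ) * L) - 1 ≤ e.1 i ∧ e.1 i ≤ b * L + b := by
      intro e he i
      simp only [Finset.mem_union] at he
      rcases he with (he | he) | he
      · have h := hmemΛ e he i
        constructor <;> linarith only [h.1, h.2, hb1]
      · have h := abs_le.1 (hRA e he i)
        constructor <;> linarith only [h.1, h.2, hRAL, hLbL, hb1]
      · obtain ⟨e', he', hn'⟩ := exists_near_of_mem_collar he
        have h := hmemΛ e' he' i
        have h' := hn' i
        constructor <;> linarith only [h.1, h.2, h'.1, h'.2]
    have hinj : Set.InjOn (Torus.proj (2 * S + 1))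
        ((Λ ∪ A.supp ∪ (plaquettesTouching Λ).biUnion plaquetteEdges).image Prod.fst :
          Set (Site 4)) := by
      refine (injOn_torusProj_of_width (M := 2 * S + 1) (lo := -((b : ℤ) * L) - 1)
        (hi := (b : ℤ) * L + b) (by
          have hRB0 : (0 : ℤ) ≤ RB := Nat.cast_nonneg RB
          push_cast; linarith only [hI1, hI2, hb1, hRB0])).mono fun x hx => ?_
      obtain ⟨e, he, rfl⟩ := Finset.mem_image.1 (Finset.mem_coe.1 hx)
      exact hwide e he
    -- (ii) the torus image of `Λ` misses the translate of the support of `B`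
    have hfar : ∀ e ∈ B.supp.image (fun e : ZdEdge 4 => (e.1 - -Pi.single 0 (t : ℤ), e.2)),
        ∀ e' ∈ Λ, torusEdge (2 * S + 1) e ≠ torusEdge (2 * S + 1) e' := by
      intro e he e' he' heq
      obtain ⟨e₀, he₀, rfl⟩ := Finset.mem_image.1 he
      have h0 := abs_le.1 (hRB e₀ he₀ 0)
      have h1 := hmemΛ e' he' 0
      have hproj : ((e₀.1 0 + t : ℤ) : ZMod (2 * S + 1)) = ((e'.1 0 : ℤ) : ZMod (2 * S + 1)) := by
        have h := congr_fun (congr_arg Prod.fst heq) 0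
        simp only [torusEdge] at h
        simpa [Torus.proj_apply] using h
      rw [ZMod.intCast_eq_intCast_iff_dvd_sub] at hproj
      -- `0 < (e₀.1 0 + t) - e'.1 0 < 2S+1`, contradicting divisibility
      have hpos : 0 < e₀.1 0 + t - e'.1 0 := by linarith only [h0.1, h1.2, hI1]
      have hlt' : e₀.1 0 + t - e'.1 0 < ((2 * S + 1 : ℕ) : ℤ) := by
        push_cast; linarith only [h0.2, h1.1, hI1, hI2, hb1]
      have hdvd : (((2 * S + 1 : ℕ) : ℤ)) ∣ e₀.1 0 + t - e'.1 0 := by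
        have h := hproj
        rwa [← neg_sub, dvd_neg] at h
      exact absurd (Int.le_of_dvd hpos hdvd) (not_le.2 hlt')
    -- (iii) the influence bound on `ℤ⁴` and the covariance bound on the torus
    have hinfl := box_influence_le ρ hρc β hb hε hFS k RA A.measurable hCA A.isCylinder hRA
    rw [← hL, ← hΛ] at hinfl
    have hcov := abs_latticeConnectedCorr_le_of_influence ρ hρc β (M := 2 * S + 1) Λ A.measurable
      B.measurable hCA hCB A.isCylinder B.isCylinder t hinj hfar (fun η η' => hinfl η η')
    -- (iv) compare with `C e^{−κ t/b}`
    have hMeq : (((2 * (2 * n + 1) + 1) ^ 4 - (2 * (2 * n) + 1) ^ 4 : ℕ) : ℝ) =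
        (((4 * n + 3) ^ 4 - (4 * n + 1) ^ 4 : ℕ) : ℝ) := by
      have h1 : 2 * (2 * n + 1) + 1 = 4 * n + 3 := by ring
      have h2 : 2 * (2 * n) + 1 = 4 * n + 1 := by ring
      rw [h1, h2]
    rw [hMeq, ← hq] at hcov
    have hqk : q ^ k ≤ Real.exp (κ * c0 - κ * t / b) := by
      have hqr : q ^ k ≤ r ^ k := pow_le_pow_left₀ hq0 hqr0 k
      refine hqr.trans ?_
      rw [← Real.exp_log (pow_pos hr0 k), Real.exp_le_exp, Real.log_pow, hlogr']
      -- `t ≤ b ((2n+1) k + c0)`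
      have htb : (t : ℝ) ≤ b * ((2 * n + 1) * k + c0) := by
        have h1 : ((t - RB - P : ℕ) : ℝ) < k * Q + Q := by exact_mod_cast hlt
        have h0 : ((t - RB - P : ℕ) : ℝ) + RB + P = t := by exact_mod_cast ht_eq
        have h2 : (Q : ℝ) = b * (2 * n + 1) := by rw [hQ]; push_cast; ring
        have h3 : (P : ℝ) = b * (RA + 1) := by rw [hP]; push_cast; ring
        have h4 : (RB : ℝ) ≤ b * RB := le_mul_of_one_le_left (by positivity) hbR
        have h5 : (k : ℝ) * Q = b * ((2 * n + 1) * k) := by rw [h2]; ring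
        rw [hc0]
        linarith only [h1, h0, h2, h3, h4, h5]
      have htb' : κ * t / b ≤ κ * ((2 * n + 1) * k + c0) := by
        rw [mul_div_assoc]
        exact mul_le_mul_of_nonneg_left ((div_le_iff₀ hbR0).2 (by linarith only [htb])) hκ0.le
      linarith only [htb']
    calc |latticeConnectedCorr ρ β (2 * S + 1) A.F B.F t|
        ≤ CB * (2 * CA * ((2 * RA + 1) ^ 4 * q ^ k)) := hcov
      _ = 2 * CA * CB * (2 * RA + 1) ^ 4 * q ^ k := by ring
      _ ≤ 2 * CA * CB * (2 * RA + 1) ^ 4 * Real.exp (κ * c0 - κ * t / b) :=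
          mul_le_mul_of_nonneg_left hqk hC0

end Summit.QuantumFields.YangMills.Theorems

end
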